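import Mathlib
import HarnessLib
import Summits.NavierStokesRegularity.NavierStokesRegularity.Theses.TaoLadderRungOne

/-!
# Route TaoLadderRungOne — the glue item `SplitCascadeIsAveragedNoDilOfSplit` (proved)

**Statement.** `SingleScaleNoDilAt → CascadeNoDilOfSingleScaleAt → SplitNoDilPackaging →
SplitCascadeIsAveragedNoDil` (item stmt-NavierStokesRegularity-20435; the glue of the gen-1 split of
crux R1-a `SplitCascadeIsAveragedNoDil`, item stmt-NavierStokesRegularity-19873, filed by tao-ladder
theory-1 g8, route rev 4 b11d01b88e0e; children v2 at rev 7 d631ca61003b).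

HONEST FRAMING: MODEL statements (Tao 2016's local cascade class, Def. 3.1, and his complex / real
averaging data, Def. 3.4 / (1.12)–(1.13)); nothing here concerns the true Navier–Stokes equations.

**Proof.** Pure logic: `SplitNoDilPackaging` asks, for every `κ > 0`, for a threshold below which
every complexified basic cascade operator normalised at a closed triangle with sides in `[4/5, 3/2]`
and input gap `≥ κ ε₀` is a dilation-free complex average of `B`; take `ε₁ = min (ε₁ᴷ¹(κ)) ε₁ᴷ²`
(the thresholds of `SingleScaleNoDilAt κ` and of `CascadeNoDilOfSingleScaleAt`), note
`[4/5, 3/2] ⊆ [1/2, 2]`, and chain the two facts. [cite: Tao2016AveragedNS, §3.2–3.9]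
-/

-- the sub-problem namespace `Summit.NavierStokesRegularity.NavierStokesRegularity` repeats the summit name by design (D-0017)
set_option linter.dupNamespace false

namespace Summit.NavierStokesRegularity.NavierStokesRegularity.Theorems

open Summit.NavierStokesRegularity.NavierStokesRegularity.Theses.TaoLadderRungOne

/-- The glue `SplitCascadeIsAveragedNoDilOfSplit` of route TaoLadderRungOne (gen-1 split of R1-a):
`SingleScaleNoDilAt → CascadeNoDilOfSingleScaleAt → SplitNoDilPackaging → SplitCascadeIsAveragedNoDil`.
[cite: Tao2016AveragedNS, §3.2–3.9] -/
theorem taoLadderRungOne_splitCascadeIsAveragedNoDilOfSplit_proof :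
    SplitCascadeIsAveragedNoDilOfSplit := by
  intro h₁ h₂ h₃
  apply h₃
  intro κ hκ
  obtain ⟨e₁, he₁, H₁⟩ := h₁ κ hκ
  obtain ⟨e₂, he₂, H₂⟩ := h₂
  refine ⟨min e₁ e₂, lt_min he₁ he₂, fun ε₀ hε₀ hle ξ hsum hwin hgap ψ hψ => ?_⟩
  have hwin' : ∀ j, 1 / 2 ≤ ‖ξ j‖ ∧ ‖ξ j‖ ≤ 2 := fun j =>
    ⟨by linarith [(hwin j).1], by linarith [(hwin j).2]⟩
  exact H₂ ε₀ hε₀ (hle.trans (min_le_right _ _)) ξ hsum hwin' ψ hψ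
    (H₁ ε₀ hε₀ (hle.trans (min_le_left _ _)) ξ hsum hwin hgap ψ hψ)

end Summit.NavierStokesRegularity.NavierStokesRegularity.Theorems
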